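import Mathlib
import Summits.ValiantsHypothesis.ValiantsHypothesis.Theorems.FifoMatchingNNDivisionHardFewArcFaces
import Summits.ValiantsHypothesis.ValiantsHypothesis.Theses.FifoMatching
import HarnessLib

/-!
# Route FifoMatching — crux `NNDivisionHard` (stmt-ValiantsHypothesis-21181): BY NAME, 21181 ⟺ its
# BOUNDED-ARC-SET NON-GENERIC tier

`…FewArcFaces.fewArcsGeneric_not_certificate_qp`: for every `k, c`, eventually in `n`, a cofactor `h` whose outer face
`top_{𝟙_{I^c}} h` is a single monomial for SOME set `I` of at most `k` arc variables is not a certificate.  Hence: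

* ★ BY NAME `nnDivisionHard_iff_fewArcsNonGenericTier` — `Theses.FifoMatching.NNDivisionHard` ⟺ for every `k` and `c`,
  eventually in `n`, every `h ≠ 0` which is NON-GENERIC FOR EVERY ARC SET OF SIZE `≤ k` (for every `I` with `|I| ≤ k` the
  face `top_{𝟙_{I^c}} h` is not of the form `a · x^d`, `a ≠ 0`) satisfies `2^((log₂ n + c)^c) < L₊(NN_n · h) + L₊(h)`.

READING (residual of this tier): symmetric cofactors — for every bounded arc set `I`, at least two monomials of `h` realise the
lexicographically extreme usage of `I` among the top-`𝟙_{I^c}` terms; e.g. `NN_n^D`, faces and block products of `NN_n`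
(decided elsewhere), and sums over families of matchings of size growing with `n`.  This subsumes the single-arc
(`…ArcGenericTier`), short-set (`…ShortArcGeneric`), stabbed (`…StabbedFaces`) and mixed (`…SplitFaceAvoiding`) genericity
tiers for bounded `|I|` (those remain useful for UNBOUNDED short / stabbed sets).

HONEST FRAMING: by-name bookkeeping; `NNDivisionHard`, `NNNotVP` and VP ≠ VNP stay OPEN (NOT proved).  No definitions, no
named facts.  References: Hrubeš–Yehudayoff 2021 §6 Problem 2 [HrubesYehudayoff2021].
-/

noncomputable section

-- Sub = Summit single-conjunct layout: the duplicated namespace component is mandated by the tree.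
set_option linter.dupNamespace false
set_option autoImplicit false

namespace Summit.ValiantsHypothesis.ValiantsHypothesis.Theorems.FifoMatching.NNDivisionHard.FewArcsTier

open Finset MvPolynomial Literature.Computability.AlgebraicComplexity
open Summit.ValiantsHypothesis.ValiantsHypothesis.Theorems.ZeroOneTransfer.Negative (topComponent)
open Summit.ValiantsHypothesis.ValiantsHypothesis.Theorems.FifoMatching.NNDivisionHard.FewArcFaces
  (fewArcsGeneric_not_certificate_qp)
open scoped NNReal BigOperators

/-- ★ **BY NAME: `NNDivisionHard` ⟺ its BOUNDED-ARC-SET NON-GENERIC tier.** [cite: HrubesYehudayoff2021, §6 Problem 2] -/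
theorem nnDivisionHard_iff_fewArcsNonGenericTier :
    Summit.ValiantsHypothesis.ValiantsHypothesis.Theses.FifoMatching.NNDivisionHard ↔
    ∀ k c : ℕ, ∃ n₀ : ℕ, ∀ n ≥ n₀, ∀ h : MvPolynomial (Fin (2 * n) × Fin (2 * n)) ℝ≥0, h ≠ 0 →
      (∀ I : Finset (Fin (2 * n) × Fin (2 * n)), I.card ≤ k →
        ∀ (d : (Fin (2 * n) × Fin (2 * n)) →₀ ℕ) (a : ℝ≥0), a ≠ 0 →
          topComponent (fun v : Fin (2 * n) × Fin (2 * n) => if v ∈ I then 0 else 1) h ≠ monomial d a) →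
      2 ^ ((Nat.log 2 n + c) ^ c) < complexity (nestFreeMatchingPoly n ℝ≥0 * h) + complexity h := by
  constructor
  · intro hN k c
    obtain ⟨n₀, hn₀⟩ := hN c
    exact ⟨n₀, fun n hn h hh _ => hn₀ n hn h hh⟩
  · intro H c
    obtain ⟨n₀, hn₀⟩ := H 0 c
    obtain ⟨n₁, hn₁⟩ := fewArcsGeneric_not_certificate_qp 0 c
    refine ⟨max n₀ n₁, fun n hn h hh => ?_⟩
    by_cases hgen : ∃ I : Finset (Fin (2 * n) × Fin (2 * n)), I.card ≤ 0 ∧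
        ∃ (d : (Fin (2 * n) × Fin (2 * n)) →₀ ℕ) (a : ℝ≥0), a ≠ 0 ∧
          topComponent (fun v : Fin (2 * n) × Fin (2 * n) => if v ∈ I then 0 else 1) h = monomial d a
    · obtain ⟨I, hI, d, a, ha, htop⟩ := hgen
      exact hn₁ n (le_trans (le_max_right _ _) hn) I hI h d a ha htop
    · push Not at hgen
      exact hn₀ n (le_trans (le_max_left _ _) hn) h hh fun I hI d a ha => hgen I hI d a ha

/-- ★ **The tier at every fixed `k`**: `NNDivisionHard` ⟹ (trivially) and ⟸ the `k`-bounded non-generic tier, for each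
single `k` (the equivalence above uses `k = 0` for ⟸; this form records that ANY fixed `k` may be assumed).
[cite: HrubesYehudayoff2021, §6 Problem 2] -/
theorem nnDivisionHard_of_fewArcsNonGenericTier (k : ℕ)
    (H : ∀ c : ℕ, ∃ n₀ : ℕ, ∀ n ≥ n₀, ∀ h : MvPolynomial (Fin (2 * n) × Fin (2 * n)) ℝ≥0, h ≠ 0 →
      (∀ I : Finset (Fin (2 * n) × Fin (2 * n)), I.card ≤ k →
        ∀ (d : (Fin (2 * n) × Fin (2 * n)) →₀ ℕ) (a : ℝ≥0), a ≠ 0 →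
          topComponent (fun v : Fin (2 * n) × Fin (2 * n) => if v ∈ I then 0 else 1) h ≠ monomial d a) →
      2 ^ ((Nat.log 2 n + c) ^ c) < complexity (nestFreeMatchingPoly n ℝ≥0 * h) + complexity h) :
    Summit.ValiantsHypothesis.ValiantsHypothesis.Theses.FifoMatching.NNDivisionHard := by
  intro c
  obtain ⟨n₀, hn₀⟩ := H c
  obtain ⟨n₁, hn₁⟩ := fewArcsGeneric_not_certificate_qp k c
  refine ⟨max n₀ n₁, fun n hn h hh => ?_⟩
  by_cases hgen : ∃ I : Finset (Fin (2 * n) × Fin (2 * n)), I.card ≤ k ∧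
      ∃ (d : (Fin (2 * n) × Fin (2 * n)) →₀ ℕ) (a : ℝ≥0), a ≠ 0 ∧
        topComponent (fun v : Fin (2 * n) × Fin (2 * n) => if v ∈ I then 0 else 1) h = monomial d a
  · obtain ⟨I, hI, d, a, ha, htop⟩ := hgen
    exact hn₁ n (le_trans (le_max_right _ _) hn) I hI h d a ha htop
  · push Not at hgen
    exact hn₀ n (le_trans (le_max_left _ _) hn) h hh fun I hI d a ha => hgen I hI d a ha

end Summit.ValiantsHypothesis.ValiantsHypothesis.Theorems.FifoMatching.NNDivisionHard.FewArcsTier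

end
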